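import Mathlib

/-!
# `SnSubsetDichotomy.ThresholdSubsetTriples`, line `SketchIdeator2` — stub `stub_cayleyDeletion`

Cayley-graph deletion (crux `stmt-MatrixMultiplication-10882`, registered stub
`stub_cayleyDeletion` of the lead's skeleton for line `SketchIdeator2`).

For finite subsets `K, B` of a group there is `X ⊆ K` avoiding `B` as a right quotient
(`x x'⁻¹ ∈ B ⇒ x = x'` for `x, x' ∈ X`) with `|K| ≤ (2|B| + 1)|X|`.  Proof: take an admissible
`X ⊆ K` of maximum cardinality (`Finset.exists_max_image` over `K.powerset.filter _`; the empty
set is admissible).  For `k ∈ K`, if `k` were outside the ball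
`⋃_{x ∈ X} ({x} ∪ B·x ∪ B⁻¹·x)` then `insert k X` would again be admissible (a bad pair must
involve `k` and some `x ∈ X`, giving `k = b x` or `k = b⁻¹ x` with `b ∈ B`) and strictly larger.
Hence `K` is covered by `|X|` balls of size `≤ 2|B| + 1` (`Finset.card_biUnion_le_card_mul`).
The general-group form is `CayleyDeletion.exists_subset_avoiding_quotients`; the stub is its
specialisation to `Equiv.Perm (Fin n)`.
-/

namespace Summit.MatrixMultiplication.MatrixMultiplication.Theorems.ThresholdSubsetTriples

namespace CayleyDeletion

variable {G : Type*} [Group G]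

/-- **Cayley-graph deletion in a group.**  For finite `K, B ⊆ G` there is `X ⊆ K` such that
`x * x'⁻¹ ∈ B` forces `x = x'` for `x, x' ∈ X`, and `K.card ≤ (2 * B.card + 1) * X.card`
(an admissible `X` of maximum size dominates `K` in the Cayley graph of `B ∪ B⁻¹`, whose closed
neighbourhoods have at most `2|B| + 1` elements). [folklore] -/
theorem exists_subset_avoiding_quotients (K B : Finset G) :
    ∃ X ⊆ K, (∀ x ∈ X, ∀ x' ∈ X, x * x'⁻¹ ∈ B → x = x') ∧
      K.card ≤ (2 * B.card + 1) * X.card := by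
  classical
  -- the admissible subsets of `K`
  set F : Finset (Finset G) :=
    K.powerset.filter (fun X => ∀ x ∈ X, ∀ x' ∈ X, x * x'⁻¹ ∈ B → x = x') with hF
  have hF0 : (∅ : Finset G) ∈ F := by simp [hF]
  obtain ⟨X, hXF, hmax⟩ := F.exists_max_image Finset.card ⟨∅, hF0⟩
  rw [hF, Finset.mem_filter, Finset.mem_powerset] at hXF
  obtain ⟨hXK, hXP⟩ := hXF
  refine ⟨X, hXK, hXP, ?_⟩
  -- closed neighbourhood of `x` in the Cayley graph of `B ∪ B⁻¹`
  let N : G → Finset G := fun x => insert x (B.image (· * x) ∪ B.image (fun b => b⁻¹ * x))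
  -- domination: `K` is covered by the neighbourhoods of the points of `X`
  have hdom : K ⊆ X.biUnion N := by
    intro k hk
    by_contra hkn
    have hkX : k ∉ X := fun h =>
      hkn (Finset.mem_biUnion.2 ⟨k, h, Finset.mem_insert_self _ _⟩)
    -- otherwise `insert k X` is admissible and larger than `X`
    have hins : insert k X ∈ F := by
      rw [hF, Finset.mem_filter, Finset.mem_powerset]
      refine ⟨Finset.insert_subset hk hXK, fun x hx x' hx' hB => ?_⟩
      rcases Finset.mem_insert.1 hx with rfl | hxX
      · rcases Finset.mem_insert.1 hx' with rfl | hx'X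
        · rfl
        · -- `k * x'⁻¹ ∈ B`, so `k = (k * x'⁻¹) * x' ∈ B · x'`
          refine absurd (Finset.mem_biUnion.2 ⟨x', hx'X, ?_⟩) hkn
          refine Finset.mem_insert_of_mem (Finset.mem_union_left _ ?_)
          exact Finset.mem_image.2 ⟨x * x'⁻¹, hB, inv_mul_cancel_right x x'⟩
      · rcases Finset.mem_insert.1 hx' with rfl | hx'X
        · -- `x * k⁻¹ ∈ B`, so `k = (x * k⁻¹)⁻¹ * x ∈ B⁻¹ · x`
          refine absurd (Finset.mem_biUnion.2 ⟨x, hxX, ?_⟩) hkn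
          refine Finset.mem_insert_of_mem (Finset.mem_union_right _ ?_)
          exact Finset.mem_image.2 ⟨x * x'⁻¹, hB, by simp⟩
        · exact hXP x hxX x' hx'X hB
    have hle := hmax _ hins
    rw [Finset.card_insert_of_notMem hkX] at hle
    omega
  -- each neighbourhood has at most `2|B| + 1` elements
  have hN : ∀ x ∈ X, (N x).card ≤ 2 * B.card + 1 := by
    intro x _
    calc (N x).card ≤ (B.image (· * x) ∪ B.image (fun b => b⁻¹ * x)).card + 1 :=
          Finset.card_insert_le _ _
      _ ≤ (B.image (· * x)).card + (B.image (fun b => b⁻¹ * x)).card + 1 :=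
          Nat.add_le_add_right (Finset.card_union_le _ _) 1
      _ ≤ B.card + B.card + 1 :=
          Nat.add_le_add_right (Nat.add_le_add Finset.card_image_le Finset.card_image_le) 1
      _ = 2 * B.card + 1 := by ring
  calc K.card ≤ (X.biUnion N).card := Finset.card_le_card hdom
    _ ≤ X.card * (2 * B.card + 1) := Finset.card_biUnion_le_card_mul X N _ hN
    _ = (2 * B.card + 1) * X.card := mul_comm _ _

end CayleyDeletion

open CayleyDeletion in
/-- **Stub `stub_cayleyDeletion` — Cayley-graph deletion** (line `SketchIdeator2` of crux
`SnSubsetDichotomy.ThresholdSubsetTriples`, stmt-MatrixMultiplication-10882).  For finite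
`K, B ⊆ S_n` there is `X ⊆ K` avoiding `B` as a right quotient (`x x'⁻¹ ∈ B ⇒ x = x'`) with
`|K| ≤ (2|B| + 1)|X|` (`CayleyDeletion.exists_subset_avoiding_quotients` specialised to
`Equiv.Perm (Fin n)`). [folklore] -/
theorem stub_cayleyDeletion : ∀ (n : ℕ) (K B : Finset (Equiv.Perm (Fin n))), ∃ X ⊆ K, (∀ x ∈ X, ∀ x' ∈ X, x * x'⁻¹ ∈ B → x = x') ∧ K.card ≤ (2 * B.card + 1) * X.card :=
  fun _ K B => exists_subset_avoiding_quotients K B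

end Summit.MatrixMultiplication.MatrixMultiplication.Theorems.ThresholdSubsetTriples
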